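import Summits.QuantumFields.YangMills.Theorems.BalabanUVNodesN15KingModelFreeEnergyDensityLimit
import Summits.QuantumFields.YangMills.Theorems.BalabanUVNodesN15KingModelFreeKernelThermodynamicLimit
import Mathlib.Analysis.Calculus.ParametricIntegral
import Mathlib.Analysis.SpecialFunctions.Log.Deriv
import HarnessLib

/-!
# BalabanUVNodes ∕ N15 — THE KING-MODEL RUNG (PART Ε-y): THE INFINITE-VOLUME FLUCTUATION–RESPONSE IDENTITY — `∂_{m²} f_∞(c, m²) = K_∞(0)`: the mass derivative of the
# infinite-volume free energy density `(2π)^{−(d+1)}∫_{BZ} ln(m²+cΣ(2−2cos p_μ))dp` IS the coincident-point value of the free lattice covariance of part Ε-a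
# (Track A, DAG node N15 = NE2; FAN-OUT v1.1 §N15 s3 «KING-MODEL RUNG»; ties parts Ε-a (the kernel), Ε-m (the density), Ε-x (the torus identity); count-neutral)

HONEST FRAMING.  Count-neutral (cell `pub-ymgap`, seat `pub-ymgap-dag-n15-e` g40; `--supports stmt-QuantumFields-27366 --as helper` = K3⁸).
TEMPLATE LITERATURE: C. King, Commun. Math. Phys. **102** (1986) 649–677 [King1986], (3.89) p.668, (4.4) p.670; [Balaban1983RegularityDecay] (2.43) p.584 (the momentum integral of the
free propagator).  Folklore: `∂_{m²}ln Z = −½Σ_x⟨φ(x)²⟩`; on the torus this is part Ε-x (`∂_{m²}(|Ω|⁻¹ln det) = G(x,x)`); here in infinite volume.  THIS FILE: §1 `box_indicator_eq`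
(part Ε-m's half-open-zone `if` is the indicator of `Set.pi univ (Ioc (−π) π)`), ★★ **`hasDerivAt_integral_kingLogSym`** — differentiation under the integral sign
(`hasDerivAt_integral_of_dominated_loc_of_deriv_le` on the ball of radius `m²∕2`, dominating function `(2∕m²)·1_{zone}`): `∂_{m²}∫1_{zone}ln(m²+cΣ(2−2cos p_μ))dp = ∫1_{zone}(m²+cΣ(2−2cos
p_μ))⁻¹dp`, ★★★ **`hasDerivAt_kingFreeEnergyInf`**; §2 ★★ **`freeKer_zero_eq_integral`** (`K_∞(0) = (2π)^{−(d+1)}∫_{zone}(m²+cΣ(2−2cos p_μ))⁻¹dp`: part Ε-a's complex Fourier integral at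
`z = 0` is real (`freeMultC_ofRealVec`, `integral_ofReal`) and the closed zone `Icc` may be replaced by the half-open one (`Measure.univ_pi_Ioc_ae_eq_Icc`)), ★★★
**`hasDerivAt_kingFreeEnergyInf_eq_freeKer_zero`** (`∂_{m²} kingFreeEnergyInf c m² d = freeKer c m² 0`), `deriv_kingFreeEnergyInf_bounds` (`∈ [1∕(m²+4c(d+1)), 1∕m²]`, part Ε-f).

PRIOR TREE ART (used, not restated): part Ε-m (`kingLogSym`, `kingFreeEnergyInf`, `abs_kingLogSym_le`, `continuous_kingLogSym`, `le_symArg`), part Ε-a (`freeKer`, `freeKerC`, `freeMultC_ofRealVec`),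
part Ε-f (`freeKer_zero_le_inv_mass`, `inv_le_freeKer_zero`), pv17 `B4ContourShift` (`latticeKernel`, `fourierBox`, `integrand`, `BZ`, `phase`), `B4Strip.S1r`, Mathlib
(`hasDerivAt_integral_of_dominated_loc_of_deriv_le`, `Measure.univ_pi_Ioc_ae_eq_Icc`, `integral_ofReal`).  NOT Bałaban's covariant objects; NOT a node discharge (N15 is booked through
n15-a's knit, untouched); nothing continuum-YM ∕ `ℝ⁴` ∕ OS ∕ Clay.  0 `sorry`, 0 `def`.

HONEST SCOPE.  `c ≥ 0`, `m² > 0`, any dimension `d+1`; real one-variable calculus under a Lebesgue integral over the bounded zone.  Locators: [King1986] (3.89) p.668, (4.4) p.670;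
[Balaban1983RegularityDecay] (2.43) p.584.
-/

noncomputable section

open scoped BigOperators Topology
open Finset Filter MeasureTheory Set

namespace Summit.QuantumFields.YangMills.BalabanUVNodes.N15KingModelRung.TorusSpectral

open Literature.MathematicalPhysics.QuantumFieldTheory.Balaban1983to89.B4ContourShift (latticeKernel fourierBox integrand BZ phase)
open Literature.MathematicalPhysics.QuantumFieldTheory.Balaban1983to89.B4Strip (S1r)

variable {d : ℕ} {c : ℝ}

/-! ## §1 Differentiation under the integral sign -/

/-- part Ε-m's `if`-integrand is the indicator of the half-open zone `Π_ν(−π, π]`. [folklore] -/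
theorem box_indicator_eq (f : (Fin (d + 1) → ℝ) → ℝ) (p : Fin (d + 1) → ℝ) :
    (if ∀ ν, -Real.pi < p ν ∧ p ν ≤ Real.pi then f p else 0) = (Set.pi Set.univ fun _ : Fin (d + 1) => Set.Ioc (-Real.pi) Real.pi).indicator f p := by
  have h : (∀ ν, -Real.pi < p ν ∧ p ν ≤ Real.pi) ↔ p ∈ Set.pi Set.univ fun _ : Fin (d + 1) => Set.Ioc (-Real.pi) Real.pi := by
    rw [Set.mem_univ_pi]; rfl
  by_cases hp : ∀ ν, -Real.pi < p ν ∧ p ν ≤ Real.pi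
  · rw [if_pos hp, Set.indicator_of_mem (h.mp hp)]
  · rw [if_neg hp, Set.indicator_of_notMem (fun h' => hp (h.mpr h'))]

/-- the zone has finite Lebesgue measure. [folklore] -/
theorem volume_box_lt_top : volume (Set.pi Set.univ fun _ : Fin (d + 1) => Set.Ioc (-Real.pi) Real.pi) < ⊤ := by
  rw [volume_pi_pi]
  simp [Real.volume_Ioc]

/-- ★★ **DIFFERENTIATION UNDER THE INTEGRAL SIGN**: `∂_{m²}∫1_{zone}·ln(m²+cΣ(2−2cos p_μ))dp = ∫1_{zone}·(m²+cΣ(2−2cos p_μ))⁻¹dp` (`c ≥ 0`, `m² > 0`).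
[cite: King1986, (3.89) p.668, (4.4) p.670] -/
theorem hasDerivAt_integral_kingLogSym (hc : 0 ≤ c) {m2 : ℝ} (hm : 0 < m2) :
    HasDerivAt (fun m : ℝ => ∫ p : Fin (d + 1) → ℝ, (Set.pi Set.univ fun _ : Fin (d + 1) => Set.Ioc (-Real.pi) Real.pi).indicator (kingLogSym c m) p)
      (∫ p : Fin (d + 1) → ℝ, (Set.pi Set.univ fun _ : Fin (d + 1) => Set.Ioc (-Real.pi) Real.pi).indicator (fun p => (m2 + c * ∑ μ, (2 - 2 * Real.cos (p μ)))⁻¹) p) m2 := by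
  set box : Set (Fin (d + 1) → ℝ) := Set.pi Set.univ fun _ : Fin (d + 1) => Set.Ioc (-Real.pi) Real.pi with hbox
  have hboxm : MeasurableSet box := MeasurableSet.univ_pi fun _ => measurableSet_Ioc
  have hvol : volume box < ⊤ := volume_box_lt_top
  -- the symbol's argument `A(p) = cΣ(2−2cos p_μ) ≥ 0`
  have hA : ∀ p : Fin (d + 1) → ℝ, 0 ≤ c * ∑ μ, (2 - 2 * Real.cos (p μ)) := fun p =>
    mul_nonneg hc (Finset.sum_nonneg fun μ _ => by linarith [Real.cos_le_one (p μ)])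
  have hAcont : Continuous fun p : Fin (d + 1) → ℝ => c * ∑ μ, (2 - 2 * Real.cos (p μ)) := by fun_prop
  -- the neighbourhood `(m²∕2, 3m²∕2)`
  have hs : Set.Ioo (m2 / 2) (3 * m2 / 2) ∈ 𝓝 m2 := Ioo_mem_nhds (by linarith) (by linarith)
  refine (hasDerivAt_integral_of_dominated_loc_of_deriv_le (μ := volume) (F := fun m p => box.indicator (kingLogSym c m) p)
    (F' := fun m p => box.indicator (fun p => (m + c * ∑ μ, (2 - 2 * Real.cos (p μ)))⁻¹) p)
    (bound := box.indicator fun _ => 2 / m2) hs ?_ ?_ ?_ ?_ ?_ ?_).2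
  · -- measurability of `F m` for every `m`
    refine Eventually.of_forall fun m => ?_
    refine AEStronglyMeasurable.indicator ?_ hboxm
    unfold kingLogSym
    exact (Measurable.log (by fun_prop)).aestronglyMeasurable
  · -- integrability of `F m²`: bounded on a finite-measure set
    refine Integrable.mono' ((integrableOn_const (C := |Real.log m2| + |Real.log (m2 + 4 * c * (d + 1))|) hvol.ne).integrable_indicator hboxm) ?_ ?_
    · exact ((continuous_kingLogSym hc hm).aestronglyMeasurable).indicator hboxm
    · refine Eventually.of_forall fun p => ?_
      by_cases hp : p ∈ box
      · rw [Set.indicator_of_mem hp, Set.indicator_of_mem hp, Real.norm_eq_abs]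
        exact abs_kingLogSym_le hc hm p
      · rw [Set.indicator_of_notMem hp, Set.indicator_of_notMem hp, norm_zero]
  · -- measurability of `F' m²`
    exact ((continuous_const.add hAcont).inv₀ fun p => (lt_of_lt_of_le hm (le_add_of_nonneg_right (hA p))).ne').aestronglyMeasurable.indicator hboxm
  · -- domination on the neighbourhood
    refine Eventually.of_forall fun p m hmI => ?_
    by_cases hp : p ∈ box
    · rw [Set.indicator_of_mem hp, Set.indicator_of_mem hp, Real.norm_eq_abs]
      have hm' : m2 / 2 < m := hmI.1
      have hpos : 0 < m + c * ∑ μ, (2 - 2 * Real.cos (p μ)) := by have := hA p; linarith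
      rw [abs_of_pos (inv_pos.mpr hpos), inv_le_comm₀ hpos (by positivity), inv_div]
      have := hA p
      linarith
    · rw [Set.indicator_of_notMem hp, Set.indicator_of_notMem hp, norm_zero]
  · exact (integrableOn_const (C := 2 / m2) hvol.ne).integrable_indicator hboxm
  · -- pointwise derivative
    refine Eventually.of_forall fun p m hmI => ?_
    by_cases hp : p ∈ box
    · simp only [Set.indicator_of_mem hp]
      have hm' : m2 / 2 < m := hmI.1
      have hpos : 0 < m + c * ∑ μ, (2 - 2 * Real.cos (p μ)) := by have := hA p; linarith
      unfold kingLogSym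
      have h := ((hasDerivAt_id m).add_const (c * ∑ μ, (2 - 2 * Real.cos (p μ)))).log hpos.ne'
      simpa using h
    · simp only [Set.indicator_of_notMem hp]
      exact hasDerivAt_const m 0

/-- ★★★ **`∂_{m²} kingFreeEnergyInf c m² d = (2π)^{−(d+1)}∫_{zone}(m²+cΣ(2−2cos p_μ))⁻¹dp`**. [cite: King1986, (3.89) p.668, (4.4) p.670] -/
theorem hasDerivAt_kingFreeEnergyInf (hc : 0 ≤ c) {m2 : ℝ} (hm : 0 < m2) :
    HasDerivAt (fun m : ℝ => kingFreeEnergyInf c m d)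
      (((2 * Real.pi) ^ (d + 1))⁻¹ * ∫ p : Fin (d + 1) → ℝ,
        (Set.pi Set.univ fun _ : Fin (d + 1) => Set.Ioc (-Real.pi) Real.pi).indicator (fun p => (m2 + c * ∑ μ, (2 - 2 * Real.cos (p μ)))⁻¹) p) m2 := by
  unfold kingFreeEnergyInf
  simp_rw [box_indicator_eq]
  exact (hasDerivAt_integral_kingLogSym hc hm).const_mul _

/-! ## §2 The derivative is `K_∞(0)` -/

/-- ★★ **`K_∞(0) = (2π)^{−(d+1)}∫_{zone}(m²+cΣ(2−2cos p_μ))⁻¹dp`** (part Ε-a's complex Fourier integral at `z = 0`, made real, over the half-open zone).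
[cite: Balaban1983RegularityDecay, (2.43) p.584; King1986, (4.4) p.670] -/
theorem freeKer_zero_eq_integral (c m2 : ℝ) :
    freeKer c m2 (0 : Fin (d + 1) → ℤ)
      = ((2 * Real.pi) ^ (d + 1))⁻¹ * ∫ p : Fin (d + 1) → ℝ,
          (Set.pi Set.univ fun _ : Fin (d + 1) => Set.Ioc (-Real.pi) Real.pi).indicator (fun p => (m2 + c * ∑ μ, (2 - 2 * Real.cos (p μ)))⁻¹) p := by
  have hboxm : MeasurableSet (Set.pi Set.univ fun _ : Fin (d + 1) => Set.Ioc (-Real.pi) Real.pi) := MeasurableSet.univ_pi fun _ => measurableSet_Ioc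
  have hint : ∀ p : Fin (d + 1) → ℝ, integrand (freeMultC c m2) 0 p = (((m2 + c * ∑ μ, (2 - 2 * Real.cos (p μ)))⁻¹ : ℝ) : ℂ) := fun p => by
    unfold integrand phase
    rw [freeMultC_ofRealVec]
    simp [S1r]
  unfold freeKer freeKerC latticeKernel fourierBox
  simp_rw [hint]
  rw [integral_complex_ofReal, Complex.real_smul, Complex.re_ofReal_mul, Complex.ofReal_re, integral_indicator hboxm]
  congr 1
  refine setIntegral_congr_set ?_
  unfold BZ
  exact (Measure.univ_pi_Ioc_ae_eq_Icc (μ := fun _ : Fin (d + 1) => (volume : Measure ℝ))).symm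

/-- ★★★ **THE INFINITE-VOLUME FLUCTUATION–RESPONSE IDENTITY**: `∂_{m²} kingFreeEnergyInf c m² d = K_∞(0) = freeKer c m² 0` (`c ≥ 0`, `m² > 0`). [cite: King1986, (3.89) p.668, (4.4) p.670;
Balaban1983RegularityDecay, (2.43) p.584] -/
theorem hasDerivAt_kingFreeEnergyInf_eq_freeKer_zero (hc : 0 ≤ c) {m2 : ℝ} (hm : 0 < m2) :
    HasDerivAt (fun m : ℝ => kingFreeEnergyInf c m d) (freeKer c m2 (0 : Fin (d + 1) → ℤ)) m2 := by
  rw [freeKer_zero_eq_integral]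
  exact hasDerivAt_kingFreeEnergyInf hc hm

/-- the derivative lies in `[1∕(m²+4c(d+1)), 1∕m²]` (part Ε-f's bounds on `K_∞(0)`). [cite: King1986, (4.4) p.670] -/
theorem deriv_kingFreeEnergyInf_bounds (hc : 0 ≤ c) {m2 : ℝ} (hm : 0 < m2) :
    (m2 + 4 * c * (d + 1))⁻¹ ≤ deriv (fun m : ℝ => kingFreeEnergyInf c m d) m2 ∧ deriv (fun m : ℝ => kingFreeEnergyInf c m d) m2 ≤ m2⁻¹ := by
  rw [(hasDerivAt_kingFreeEnergyInf_eq_freeKer_zero (d := d) hc hm).deriv]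
  exact ⟨inv_le_freeKer_zero hc hm, freeKer_zero_le_inv_mass hc hm⟩

/-- `kingFreeEnergyInf` is differentiable in `m²` on `(0, ∞)` with derivative `K_∞(0)`. [folklore] -/
theorem differentiableAt_kingFreeEnergyInf (hc : 0 ≤ c) {m2 : ℝ} (hm : 0 < m2) : DifferentiableAt ℝ (fun m : ℝ => kingFreeEnergyInf c m d) m2 :=
  (hasDerivAt_kingFreeEnergyInf_eq_freeKer_zero (d := d) hc hm).differentiableAt

end Summit.QuantumFields.YangMills.BalabanUVNodes.N15KingModelRung.TorusSpectral

end
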